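import Summits.ValiantsHypothesis.ValiantsHypothesis.Cruxes.OrbitDimensionBound.Lines.MultipleLadder

set_option linter.dupNamespace false

/-!
# F4 ON-PATH lemma `S → Rung` for the rung `AffineMultipleShadow` (ladder `Lines/MultipleLadder.lean`, forward rung g11)

`ValiantsHypothesis → AffineMultipleShadow`, BY NAME and sorry-free (`MultipleLadder.affineMultipleShadow_of_summit`,
`AffineMultipleShadow_of_ValiantsHypothesis`): a p-bounded sequence of `T_Λ`-equivariant affine determinantal
representations of multiples `per_n · q_n` (`deg q_n ≤ δ`) gives p-bounded circuits for `per_n · q_n`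
(`L(det B) ≤ L(DET_m) + Σ L(B[i,j])`), hence — by the ladder's Kaltofen-free exact DIVISION `complexity_le_of_mul`
(shift a point with `q_n(a) ≠ 0` to the origin, multiply by the truncated GEOMETRIC series of `1 - q̃/c`, cut above
degree `n` with one homogeneous-component pass; `L(q_n) ≤ (n²+1)^δ (2δ+2)` since `deg q_n ≤ δ`) — p-bounded circuits
for `per_n`, i.e. `PER` p-computable, i.e. `VP_ℂ = VNP_ℂ` (`isPComputable_perPoly_complex_iff`).  Registered as an
`aesop` SAFE rule in the ladder, so the tribunal's forward kernel closes `S → AffineMultipleShadow` by `intro h; aesop`.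
Every notch `δ` is on the path.
-/

namespace Summit.ValiantsHypothesis.ValiantsHypothesis.Cruxes.OrbitDimensionBound.Multiple

open Literature.Computability.AlgebraicComplexity

/-- **ON-PATH `S → MultipleShadow δ`** for every notch `δ` (F4 name shape). [cite: Burgisser2000, Rem. 2.7, Thm. 2.21] -/
theorem MultipleShadow_of_ValiantsHypothesis (δ : ℕ) : _root_.ValiantsHypothesis → MultipleShadow δ :=
  multipleShadow_of_summit δ

/-- The kernel's structural test, replayed on the rung (closed by the registered safe rule). -/
example : _root_.ValiantsHypothesis → AffineMultipleShadow := by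
  intro h; aesop

/-- The same, by name. -/
example : _root_.ValiantsHypothesis → AffineMultipleShadow := AffineMultipleShadow_of_ValiantsHypothesis

/-- The quadratic-cofactor notch, for illustration. -/
example : _root_.ValiantsHypothesis → MultipleShadow 2 := MultipleShadow_of_ValiantsHypothesis 2

/-- The division behind it, as a standalone statement: `L(per_n)` is polynomially bounded by `L(per_n · q)` for a
non-zero cofactor of degree `≤ δ`. -/
example (n δ : ℕ) (q : MvPolynomial (Fin n × Fin n) ℂ) (hq0 : q ≠ 0) (hqd : q.totalDegree ≤ δ) :
    complexity (perPoly (Fin n) ℂ) ≤ divBound δ n (complexity (perPoly (Fin n) ℂ * q)) :=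
  complexity_perPoly_le_of_mul n δ q hq0 hqd

end Summit.ValiantsHypothesis.ValiantsHypothesis.Cruxes.OrbitDimensionBound.Multiple
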